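import Summits.ResolutionOfSingularities.ResolutionOfSingularities.Theorems.HomologicalConductorNoZenoStageRational
import Mathlib.RingTheory.RingHom.EssFiniteType
import Summits.ResolutionOfSingularities.ResolutionOfSingularities.Theorems.HomologicalConductorNoZenoThreadStep
import Summits.ResolutionOfSingularities.ResolutionOfSingularities.Theorems.HomologicalConductorNoZenoTowerNoetherian
import HarnessLib

/-!
# Route `HomologicalConductor`, crux `NoZenoR` (stmt-ResolutionOfSingularities-19943; aside twin `NoZeno` 16483):
# SANDWICHED germs — the habitat (H-sw) of the β2(n=3) descent line, its free heredity, and its rationality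

`[OURS · L W4.4]` Cell res-hironaka, crux chain W4.4, object (ρ29d)(8) «SANDWICHED-HEREDITY PREP» of planner
res-L0-w44-plan-1 (v25 «HABITAT CUT»), executed by res-L0-w44-stub-3.  Nothing here is a statement of the manuscript
under review (Hironaka 2017); AI-written, weaker than expert review.

* `IsSandwichedGerm D` — **(H-sw) «SANDWICHED germ»** (after Spivakovsky, Ann. of Math. 131 (1990), sandwiched surface
  singularities: birational and essentially of finite type over a regular surface germ): there is a two-dimensional
  REGULAR local ring `R` and an injective ring map `φ : R → D`, essentially of finite type (Mathlib
  `RingHom.EssFiniteType`: `D` is a localization of a finitely generated `R`-algebra), BIRATIONAL (`D ⊆ Frac R`: every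
  `d ∈ D` satisfies `φ s · d = φ r` with `s ≠ 0`) and DOMINATED (`φ` reflects units; for local `D` this is
  `φ⁻¹(𝔪_D) = 𝔪_R`).  Stated for an abstract commutative ring in RING-HOM form (no `Algebra`/`IsLocalRing` instance
  needed), so that it applies verbatim to the thread germs `Beta2Descent.germ O A P hP n` (subrings of `K` whose
  `IsLocalRing` is a theorem, not an instance).  OURS.
* `IsSandwichedGerm.of_isRegularLocalRing` — a two-dimensional regular local ring is sandwiched (by itself).
* `IsSandwichedGerm.of_ringHom` — **HEREDITY, free**: if `D` (a domain) is sandwiched and `f : D → D′` is injective,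
  essentially of finite type, birational (`D′ ⊆ Frac D`) and unit-reflecting, then `D′` is sandwiched (compose; the
  planner's «D_n → D_(n+1) injective, birational, ess. finite type» along a thread).
* `IsSandwichedGerm.hasRationalSingularity` — **SANDWICHED ⇒ RATIONAL, modulo the named fact `Lipman1969_1_2`**
  (Lipman 1969, Prop. (1.2) 1): a normal two-dimensional local ring of a scheme birational of finite type over a
  rational — here regular, `hasRationalSingularity_of_isRegularLocalRing` — surface germ is rational): for `D` a
  two-dimensional normal local domain, `IsSandwichedGerm D → HasRationalSingularity D`.  PROVED from the tree's
  transport `SandwichCluster.hasRationalSingularity_of_isLocalization` (p501947) by presenting `D` as the localization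
  of the finite-type subalgebra `Algebra.EssFiniteType.subalgebra R D` at the contraction of `𝔪_D`, with a common
  denominator for its generators (`exists_denominator_of_essFiniteType`).  REPORT for (ρ29d)(8): the typed (1.2)
  COVERS «dominates a REGULAR 2-dim local ring» — MATCH (regular ⇒ rational by Definition (1.1) with `X = Spec R`;
  the affine model `Spec B → Spec R`, `B ⊆ R[1/r]`, is integral, of finite type, separated, quasi-compact and birational,
  and `D ≅ 𝒪_(Spec B, 𝔮)` is a normal stalk of dimension two).
* §Thread — **HEREDITY ALONG A PRIME THREAD of the crux chain** (`D_m := Parasite.locPrime (tower O A m) (P m)`,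
  `Beta2Descent.germ O A P hP n = D_(n+1)`): `locPrime_tower_subset_succ/_of_le` (`D_m ⊆ D_(m')`),
  `isUnit_of_isUnit_inclusion_locPrime` (domination, from thread compatibility), `exists_fraction_inclusion_locPrime`
  (birational, `Frac A = K`), `essFiniteType_inclusion_locPrime` (`tn_tower_invariant` + localisation +
  `Algebra.EssFiniteType.of_comp`), hence **`isSandwichedGerm_locPrime_succ` / `isSandwichedGerm_locPrime_of_le`:
  ONE sandwiched thread germ makes every later thread germ sandwiched** — the habitat heredity of the (V26)
  «habitat cut» for 𝓗 = sandwiched is a THEOREM, for every thread, independent of the sandwich predicate.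

References: M. Spivakovsky, *Sandwiched singularities and desingularization of surfaces by normalized Nash
transformations*, Ann. of Math. 131 (1990) 411–491, Def. 1.1 [Spivakovsky1990] (terminology only; nothing of that
paper is typed here); J. Lipman, Publ. Math. IHÉS 36 (1969), Def. (1.1), Prop. (1.2) [Lipman1969].
-/

-- single-problem summit: the doubled namespace component `ResolutionOfSingularities` is forced
set_option linter.dupNamespace false

noncomputable section

open IsLocalRing
open Literature.AlgebraicGeometry.Resolution
open Summit.ResolutionOfSingularities.ResolutionOfSingularities.Theorems.NoZeno.SandwichCluster

namespace Summit.ResolutionOfSingularities.ResolutionOfSingularities.Theorems.NoZeno.Sandwiched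

/-! ## The habitat -/

/-- **(H-sw) SANDWICHED germ**: `D` is birational, essentially of finite type and dominant over a two-dimensional
regular local ring — there are a regular local ring `R` of Krull dimension `2` and an injective ring map `φ : R → D`
with `φ` essentially of finite type (`RingHom.EssFiniteType`), `D ⊆ Frac R` (`∀ d, ∃ r s, s ≠ 0 ∧ φ s * d = φ r`) and
`φ` unit-reflecting (`IsUnit (φ r) → IsUnit r`, i.e. `R → D` is a local map when `D` is local).  Ring-hom form over an
abstract ring (applies to `Beta2Descent.germ O A P hP n`).  OURS (after Spivakovsky's sandwiched surface
singularities). [this work] -/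
def IsSandwichedGerm (D : Type) [CommRing D] : Prop :=
  ∃ (R : Type) (_ : CommRing R) (φ : R →+* D),
    IsRegularLocalRing R ∧ ringKrullDim R = 2 ∧ Function.Injective φ ∧ φ.EssFiniteType ∧
    (∀ d : D, ∃ r s : R, s ≠ 0 ∧ φ s * d = φ r) ∧ (∀ r : R, IsUnit (φ r) → IsUnit r)

/-- Unfolding of `IsSandwichedGerm` (`Iff.rfl`). [folklore] -/
theorem isSandwichedGerm_iff (D : Type) [CommRing D] :
    IsSandwichedGerm D ↔ ∃ (R : Type) (_ : CommRing R) (φ : R →+* D),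
      IsRegularLocalRing R ∧ ringKrullDim R = 2 ∧ Function.Injective φ ∧ φ.EssFiniteType ∧
      (∀ d : D, ∃ r s : R, s ≠ 0 ∧ φ s * d = φ r) ∧ (∀ r : R, IsUnit (φ r) → IsUnit r) :=
  Iff.rfl

/-- **A two-dimensional regular local ring is sandwiched** (by the identity). [this work] -/
theorem IsSandwichedGerm.of_isRegularLocalRing (D : Type) [CommRing D] [IsRegularLocalRing D]
    (h2 : ringKrullDim D = 2) : IsSandwichedGerm D :=
  ⟨D, inferInstance, RingHom.id D, ‹_›, h2, Function.injective_id,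
    (RingHom.FiniteType.id D).essFiniteType, fun d => ⟨d, 1, one_ne_zero, by simp⟩, fun _ hr => hr⟩

/-! ## Heredity (free) -/

/-- **HEREDITY of the sandwiched habitat**: if the domain `D` is sandwiched and `f : D → D′` is injective, essentially
of finite type, birational (`D′ ⊆ Frac D`: `∀ d′, ∃ a b, b ≠ 0 ∧ f b * d′ = f a`) and unit-reflecting, then `D′` is
sandwiched — by the composite `R → D → D′` (injective; essentially of finite type by `RingHom.EssFiniteType.comp`;
birational by clearing the two denominators; unit-reflecting by composition).  This is the step `D_(n+1) → D_(n+2)`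
along a thread (an inclusion of local subrings of `K` with the same fraction field, a localisation of the
normalisation of a blow-up chart). [this work] -/
theorem IsSandwichedGerm.of_ringHom {D D' : Type} [CommRing D] [CommRing D'] [IsDomain D]
    (h : IsSandwichedGerm D) (f : D →+* D') (hf : Function.Injective f) (hfe : f.EssFiniteType)
    (hbir : ∀ d' : D', ∃ a b : D, b ≠ 0 ∧ f b * d' = f a)
    (hloc : ∀ d : D, IsUnit (f d) → IsUnit d) : IsSandwichedGerm D' := by
  obtain ⟨R, _, φ, hreg, hdim, hφ, hφe, hφb, hφl⟩ := h
  haveI := hreg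
  haveI : IsDomain R := isDomain_of_isRegularLocalRing R
  refine ⟨R, inferInstance, f.comp φ, hreg, hdim, hf.comp hφ, hφe.comp hfe, fun d' => ?_,
    fun r hr => hφl r (hloc _ hr)⟩
  obtain ⟨a, b, hb, hab⟩ := hbir d'
  obtain ⟨r, s, hs, hrs⟩ := hφb a
  obtain ⟨r', s', hs', hrs'⟩ := hφb b
  have hr' : r' ≠ 0 := by
    rintro rfl
    rw [map_zero] at hrs'
    exact (mul_ne_zero ((map_ne_zero_iff φ hφ).mpr hs') hb) hrs'
  refine ⟨r * s', r' * s, mul_ne_zero hr' hs, ?_⟩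
  simp only [RingHom.comp_apply, map_mul]
  rw [← hrs', ← hrs, map_mul, map_mul]
  linear_combination (f (φ s') * f (φ s)) * hab

/-! ## Sandwiched ⇒ rational (modulo `Lipman1969_1_2`) -/

section Rational

variable {R D : Type} [CommRing R] [IsDomain R] [CommRing D] [Algebra R D]

/-- **A common denominator for an essentially-of-finite-type birational extension**: if `D ⊆ Frac R` (every element
of `D` is `a/s` with `a, s ∈ R`, `s ≠ 0`) and `R → D` is injective, the finite-type subalgebra
`B = R[x₁, …, x_m] = Algebra.EssFiniteType.subalgebra R D` of which `D` is a localisation lies in `R[1/r]` for ONE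
`r ≠ 0` (the product of denominators of the `xᵢ`): every `b ∈ B` has `a = rⁿ·b` for some `n`, `a ∈ R`.
[this work] -/
theorem exists_denominator_of_essFiniteType [Algebra.EssFiniteType R D]
    (hbir : ∀ d : D, ∃ r s : R, s ≠ 0 ∧ algebraMap R D s * d = algebraMap R D r) :
    ∃ r : R, r ≠ 0 ∧ ∀ b ∈ Algebra.EssFiniteType.subalgebra R D,
      ∃ (n : ℕ) (a : R), algebraMap R D a = algebraMap R D r ^ n * b := by
  classical
  choose num den hden hnd using hbir
  set σ := Algebra.EssFiniteType.finset R D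
  refine ⟨∏ x ∈ σ, den x, Finset.prod_ne_zero_iff.mpr fun x _ => hden x, ?_⟩
  set r := ∏ x ∈ σ, den x with hr
  -- the elements with a power of `r` as denominator form a subalgebra containing the generators
  let S : Subalgebra R D :=
    { carrier := {b | ∃ (n : ℕ) (a : R), algebraMap R D a = algebraMap R D r ^ n * b}
      mul_mem' := by
        rintro b b' ⟨n, a, ha⟩ ⟨n', a', ha'⟩
        refine ⟨n + n', a * a', ?_⟩
        rw [map_mul, ha, ha', pow_add]; ring
      one_mem' := ⟨0, 1, by simp⟩
      add_mem' := by
        rintro b b' ⟨n, a, ha⟩ ⟨n', a', ha'⟩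
        refine ⟨n + n', a * r ^ n' + a' * r ^ n, ?_⟩
        rw [map_add, map_mul, map_mul, map_pow, map_pow, ha, ha', pow_add]; ring
      zero_mem' := ⟨0, 0, by simp⟩
      algebraMap_mem' := fun a => ⟨0, a, by simp⟩ }
  have hgen : (σ : Set D) ⊆ S := by
    intro x hx
    refine ⟨1, (∏ y ∈ σ.erase x, den y) * num x, ?_⟩
    rw [pow_one, hr, ← Finset.prod_erase_mul σ den hx]
    simp only [map_mul, map_prod]
    rw [← hnd x]
    ring
  intro b hb
  exact Algebra.adjoin_le hgen hb

end Rational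

/-- **SANDWICHED ⇒ RATIONAL** (Lipman 1969, Prop. (1.2) 1), via the named fact `Lipman1969_1_2`): a two-dimensional
normal local domain `D` which is sandwiched has a rational singularity.  Proof: the regular `R` is rational
(`hasRationalSingularity_of_isRegularLocalRing`, Def. (1.1) with `X = Spec R`), normal and a domain; `D` is the
localisation of the finite-type `R`-subalgebra `B = Algebra.EssFiniteType.subalgebra R D ⊆ R[1/r]`
(`exists_denominator_of_essFiniteType`) at the prime `𝔮 = 𝔪_D ∩ B` (Mathlib `Algebra.EssFiniteType.isLocalization`,
the localising submonoid being exactly `B ∖ 𝔮` because `D` is local); conclude by the tree's transport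
`SandwichCluster.hasRationalSingularity_of_isLocalization` ((1.2) 1) at the stalk `𝒪_(Spec B, 𝔮) ≅ D`).
[cite: Lipman1969, Proposition (1.2) (p. 199)] -/
theorem IsSandwichedGerm.hasRationalSingularity (h12 : Lipman1969_1_2.{0}) {D : Type} [CommRing D]
    [IsDomain D] [IsLocalRing D] [IsIntegrallyClosed D] (hdim : ringKrullDim D = 2)
    (h : IsSandwichedGerm D) : HasRationalSingularity D := by
  obtain ⟨R, _, φ, hreg, hdimR, hφ, hφe, hφb, -⟩ := h
  haveI := hreg
  haveI : IsDomain R := isDomain_of_isRegularLocalRing R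
  haveI : IsIntegrallyClosed R := isIntegrallyClosed_of_isRegularLocalRing R
  have hR : HasRationalSingularity R := hasRationalSingularity_of_isRegularLocalRing R
  letI : Algebra R D := φ.toAlgebra
  haveI : Algebra.EssFiniteType R D := hφe
  have hφ' : (algebraMap R D) = φ := rfl
  -- the finite-type model `B` and the common denominator
  obtain ⟨r, hr, hB⟩ := exists_denominator_of_essFiniteType (R := R) (D := D)
    (fun d => by rw [hφ']; exact hφb d)
  set B := Algebra.EssFiniteType.subalgebra R D with hBdef
  have hinj : Function.Injective (algebraMap R ↥B) := by
    intro a a' h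
    apply hφ
    have := congrArg (fun b : ↥B => (b : D)) h
    rw [← hφ']
    simpa using this
  have hB' : ∀ b : ↥B, ∃ (n : ℕ) (a : R), algebraMap R ↥B a = algebraMap R ↥B r ^ n * b := by
    intro b
    obtain ⟨n, a, ha⟩ := hB b b.2
    refine ⟨n, a, Subtype.ext ?_⟩
    simpa using ha
  -- `D` is the localisation of `B` at `𝔮 = 𝔪_D ∩ B`
  let 𝔮 : Ideal ↥B := (maximalIdeal D).comap (algebraMap ↥B D)
  haveI h𝔮 : 𝔮.IsPrime := Ideal.IsPrime.comap _
  have hM : Algebra.EssFiniteType.submonoid R D = 𝔮.primeCompl := by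
    ext x
    simp only [Algebra.EssFiniteType.submonoid, Submonoid.mem_comap, IsUnit.mem_submonoid_iff,
      Ideal.primeCompl, 𝔮]
    change _ ↔ x ∉ (maximalIdeal D).comap (algebraMap ↥B D)
    rw [Ideal.mem_comap]
    exact (IsLocalRing.notMem_maximalIdeal).symm
  haveI : IsLocalization.AtPrime D 𝔮 := by
    change IsLocalization 𝔮.primeCompl D
    rw [← hM]
    exact Algebra.EssFiniteType.isLocalization R D
  exact hasRationalSingularity_of_isLocalization h12 hdimR hR hinj r hr hB' 𝔮 hdim


/-! ## Heredity ALONG A THREAD: the germs `D_m := (T_m)_(P_m)` of a prime thread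

For thread data `(O, A, P, hP, hcompat)` of the crux chain (stages `T_m := tower O A m`, primes `P m` with
`P (m+1) ∩ T_m = P m`), the explicit localisations `D_m := Parasite.locPrime (T_m) (P m)` (subrings of `K`;
`Beta2Descent.germ O A P hP n = D_(n+1)`) increase with `m`, and each inclusion `D_m ⊆ D_(m+1)` is injective,
essentially of finite type (both are essentially of finite type over `k`, `tn_tower_invariant`), birational
(`Frac A = K`) and unit-reflecting (thread compatibility).  Hence `IsSandwichedGerm D_m → IsSandwichedGerm D_(m')`
for all `m ≤ m'` — the habitat heredity `Sig.Her 𝓢 IsSandwichedGerm` of the (V26) «habitat cut» is FREE (it does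
not even look at the sandwich predicate `𝓢`). -/

section Thread

open Summit.ResolutionOfSingularities.ResolutionOfSingularities.Theses.HomologicalConductor
open Summit.ResolutionOfSingularities.ResolutionOfSingularities.Theorems.NoZeno.Birth
open Summit.ResolutionOfSingularities.ResolutionOfSingularities.Theorems.NoZeno.SandwichCluster.Parasite
  (locPrime mem_locPrime_iff mem_locPrime_of_mem NumInP inv_not_mem_locPrime_of_numInP
    inv_mem_locPrime_of_not_numInP ne_zero_of_not_mem_ideal)
open Summit.ResolutionOfSingularities.ResolutionOfSingularities.Theorems.NoZeno.SandwichCluster.Thread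
  (toSubring_le_locPrime isLocalization_locPrime)

variable {k K : Type} [Field k] [Field K] [Algebra k K]
variable (O : ValuationSubring K) (A : Subalgebra k K)
  (P : ∀ m : ℕ, Ideal ↥(tower O A m)) (hP : ∀ m, (P m).IsPrime)
  (hcompat : ∀ (m : ℕ) (x : K) (hx : x ∈ tower O A m) (hx' : x ∈ tower O A (m + 1)),
    (⟨x, hx'⟩ : ↥(tower O A (m + 1))) ∈ P (m + 1) ↔ (⟨x, hx⟩ : ↥(tower O A m)) ∈ P m)

include hcompat in
/-- **The thread germs increase**: `D_m ⊆ D_(m+1)` inside `K` (a fraction `a * b⁻¹`, `a, b ∈ T_m`, `b ∉ P_m`, has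
`a, b ∈ T_(m+1)` and `b ∉ P_(m+1)` by thread compatibility). [this work] -/
theorem locPrime_tower_subset_succ (m : ℕ) :
    (locPrime (tower O A m) (P m) (hP m) : Set K) ⊆ locPrime (tower O A (m + 1)) (P (m + 1)) (hP (m + 1)) := by
  rintro y ⟨a, b, ha, hb, hbP, rfl⟩
  exact ⟨a, b, d2rc_mem_tower_of_le O A (Nat.le_succ m) ha, d2rc_mem_tower_of_le O A (Nat.le_succ m) hb,
    fun h => hbP ((hcompat m b hb _).mp h), rfl⟩

include hcompat in
/-- `D_m ⊆ D_(m')` for `m ≤ m'`. [this work] -/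
theorem locPrime_tower_subset_of_le {m m' : ℕ} (h : m ≤ m') :
    (locPrime (tower O A m) (P m) (hP m) : Set K) ⊆ locPrime (tower O A m') (P m') (hP m') := by
  induction h with
  | refl => exact le_rfl
  | step _ ih => exact ih.trans (locPrime_tower_subset_succ O A P hP hcompat _)

include hcompat in
/-- **The inclusion `D_m → D_(m+1)` reflects units** (domination along the thread): a non-unit `a * b⁻¹` of `D_m`
has numerator `a ∈ P_m`, hence `a ∈ P_(m+1)` (compatibility), so its inverse is not in `D_(m+1)` either.
[this work] -/
theorem isUnit_of_isUnit_inclusion_locPrime (m : ℕ) (d : ↥(locPrime (tower O A m) (P m) (hP m)))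
    (hu : IsUnit (Subring.inclusion (locPrime_tower_subset_succ O A P hP hcompat m) d)) : IsUnit d := by
  rw [isUnit_subring_iff_inv_mem] at hu ⊢
  obtain ⟨hd0, hinv⟩ := hu
  refine ⟨hd0, ?_⟩
  by_contra hninv
  have hnum : NumInP (tower O A m) (P m) (d : K) := by
    by_contra hn
    exact hninv (inv_mem_locPrime_of_not_numInP _ _ (hP m) d.2 hn)
  obtain ⟨a, b, ha, hb, hbP, haP, hd⟩ := hnum
  have hnum' : NumInP (tower O A (m + 1)) (P (m + 1)) (d : K) :=
    ⟨a, b, d2rc_mem_tower_of_le O A (Nat.le_succ m) ha, d2rc_mem_tower_of_le O A (Nat.le_succ m) hb,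
      fun h => hbP ((hcompat m b hb _).mp h), (hcompat m a ha _).mpr haP, hd⟩
  exact inv_not_mem_locPrime_of_numInP _ _ (hP (m + 1)) hnum' hd0 hinv

/-- **Birationality of `D_m → D_(m+1)`**: every element of `D_(m+1) ⊆ K = Frac A` is a fraction of two elements of
`A ⊆ T_m ⊆ D_m`. [this work] -/
theorem exists_fraction_inclusion_locPrime (hk : ∀ c : k, algebraMap k K c ∈ O) (hA : A.FG)
    (hfr : IsFractionRing ↥A K) (hAO : A.toSubring ≤ O.toSubring)
    (hcompat : ∀ (m : ℕ) (x : K) (hx : x ∈ tower O A m) (hx' : x ∈ tower O A (m + 1)),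
      (⟨x, hx'⟩ : ↥(tower O A (m + 1))) ∈ P (m + 1) ↔ (⟨x, hx⟩ : ↥(tower O A m)) ∈ P m)
    (m : ℕ) (d' : ↥(locPrime (tower O A (m + 1)) (P (m + 1)) (hP (m + 1)))) :
    ∃ a b : ↥(locPrime (tower O A m) (P m) (hP m)), b ≠ 0 ∧
      Subring.inclusion (locPrime_tower_subset_succ O A P hP hcompat m) b * d' =
        Subring.inclusion (locPrime_tower_subset_succ O A P hP hcompat m) a := by
  haveI := hfr
  obtain ⟨hAT, -, -⟩ := tn_tower_invariant O A hk hA hfr hAO m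
  obtain ⟨⟨a, b⟩, hab⟩ := IsLocalization.surj (nonZeroDivisors ↥A) (d' : K)
  have hbK : ((b : ↥A) : K) ≠ 0 := by
    intro h
    exact nonZeroDivisors.ne_zero b.2 (Subtype.ext h)
  have haD : (a : K) ∈ locPrime (tower O A m) (P m) (hP m) :=
    mem_locPrime_of_mem _ _ (hP m) (hAT a.2)
  have hbD : ((b : ↥A) : K) ∈ locPrime (tower O A m) (P m) (hP m) :=
    mem_locPrime_of_mem _ _ (hP m) (hAT b.1.2)
  refine ⟨⟨a, haD⟩, ⟨b, hbD⟩, fun h => hbK (congrArg Subtype.val h), Subtype.ext ?_⟩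
  -- in `K`: `b * d' = a`
  have hab' : (d' : K) * ((b : ↥A) : K) = (a : K) := hab
  change ((b : ↥A) : K) * (d' : K) = (a : K)
  rw [mul_comm]; exact hab'

/-- **`D_m → D_(m+1)` is essentially of finite type**: both germs are essentially of finite type over `k`
(`tn_tower_invariant` + localisation), and `k → D_m → D_(m+1)` is a tower (`Algebra.EssFiniteType.of_comp`).
[this work] -/
theorem essFiniteType_inclusion_locPrime (hk : ∀ c : k, algebraMap k K c ∈ O) (hA : A.FG)
    (hfr : IsFractionRing ↥A K) (hAO : A.toSubring ≤ O.toSubring)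
    (hcompat : ∀ (m : ℕ) (x : K) (hx : x ∈ tower O A m) (hx' : x ∈ tower O A (m + 1)),
      (⟨x, hx'⟩ : ↥(tower O A (m + 1))) ∈ P (m + 1) ↔ (⟨x, hx⟩ : ↥(tower O A m)) ∈ P m)
    (m : ℕ) :
    (Subring.inclusion (locPrime_tower_subset_succ O A P hP hcompat m)).EssFiniteType := by
  haveI := hfr
  -- `k`-algebra structures on the two germs through the stages
  have hkD : ∀ j : ℕ, ∃ (_ : Algebra k ↥(locPrime (tower O A j) (P j) (hP j))),
      (∀ c : k, (algebraMap k ↥(locPrime (tower O A j) (P j) (hP j)) c : K) = algebraMap k K c) ∧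
      Algebra.EssFiniteType k ↥(locPrime (tower O A j) (P j) (hP j)) := by
    intro j
    obtain ⟨-, -, hET⟩ := tn_tower_invariant O A hk hA hfr hAO j
    haveI := hET
    haveI := hP j
    letI algTD : Algebra ↥(tower O A j) ↥(locPrime (tower O A j) (P j) (hP j)) :=
      (Subring.inclusion (toSubring_le_locPrime (tower O A j) (P j) (hP j))).toAlgebra
    haveI := isLocalization_locPrime (tower O A j) (P j) (hP j)
    letI algkD : Algebra k ↥(locPrime (tower O A j) (P j) (hP j)) :=
      ((algebraMap ↥(tower O A j) ↥(locPrime (tower O A j) (P j) (hP j))).comp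
        (algebraMap k ↥(tower O A j))).toAlgebra
    haveI : IsScalarTower k ↥(tower O A j) ↥(locPrime (tower O A j) (P j) (hP j)) :=
      IsScalarTower.of_algebraMap_eq fun _ => rfl
    haveI : Algebra.EssFiniteType ↥(tower O A j) ↥(locPrime (tower O A j) (P j) (hP j)) :=
      Algebra.EssFiniteType.of_isLocalization _ (P j).primeCompl
    exact ⟨algkD, fun c => rfl, Algebra.EssFiniteType.comp k ↥(tower O A j) _⟩
  obtain ⟨alg₀, halg₀, hE₀⟩ := hkD m
  obtain ⟨alg₁, halg₁, hE₁⟩ := hkD (m + 1)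
  letI := alg₀
  letI := alg₁
  letI algDD : Algebra ↥(locPrime (tower O A m) (P m) (hP m))
      ↥(locPrime (tower O A (m + 1)) (P (m + 1)) (hP (m + 1))) :=
    (Subring.inclusion (locPrime_tower_subset_succ O A P hP hcompat m)).toAlgebra
  haveI : IsScalarTower k ↥(locPrime (tower O A m) (P m) (hP m))
      ↥(locPrime (tower O A (m + 1)) (P (m + 1)) (hP (m + 1))) := by
    refine IsScalarTower.of_algebraMap_eq fun c => Subtype.ext ?_
    exact ((halg₁ c).trans (halg₀ c).symm : _)
  haveI := hE₁
  exact Algebra.EssFiniteType.of_comp k _ _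

include hcompat in
/-- **HEREDITY OF THE SANDWICHED HABITAT ALONG A THREAD, one step**: `D_m` sandwiched ⇒ `D_(m+1)` sandwiched.
[this work] -/
theorem isSandwichedGerm_locPrime_succ (hk : ∀ c : k, algebraMap k K c ∈ O) (hA : A.FG)
    (hfr : IsFractionRing ↥A K) (hAO : A.toSubring ≤ O.toSubring) (m : ℕ)
    (h : IsSandwichedGerm ↥(locPrime (tower O A m) (P m) (hP m))) :
    IsSandwichedGerm ↥(locPrime (tower O A (m + 1)) (P (m + 1)) (hP (m + 1))) :=
  h.of_ringHom (Subring.inclusion (locPrime_tower_subset_succ O A P hP hcompat m))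
    (Subring.inclusion_injective _) (essFiniteType_inclusion_locPrime O A P hP hk hA hfr hAO hcompat m)
    (exists_fraction_inclusion_locPrime O A P hP hk hA hfr hAO hcompat m)
    (isUnit_of_isUnit_inclusion_locPrime O A P hP hcompat m)

include hcompat in
/-- **HEREDITY along a thread**: `D_m` sandwiched ⇒ `D_(m')` sandwiched for every `m' ≥ m`; in particular, with
`Beta2Descent.germ O A P hP n = D_(n+1)`, ONE sandwiched thread germ makes every later thread germ sandwiched.
[this work] -/
theorem isSandwichedGerm_locPrime_of_le (hk : ∀ c : k, algebraMap k K c ∈ O) (hA : A.FG)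
    (hfr : IsFractionRing ↥A K) (hAO : A.toSubring ≤ O.toSubring) {m m' : ℕ} (hmm' : m ≤ m')
    (h : IsSandwichedGerm ↥(locPrime (tower O A m) (P m) (hP m))) :
    IsSandwichedGerm ↥(locPrime (tower O A m') (P m') (hP m')) := by
  induction hmm' with
  | refl => exact h
  | step _ ih => exact isSandwichedGerm_locPrime_succ O A P hP hcompat hk hA hfr hAO _ ih

/-- **Sandwiched thread germs are rational** (modulo `Lipman1969_1_2`): the germ-level form of
`IsSandwichedGerm.hasRationalSingularity` for `D = locPrime T P` (a subring of the field `K`, hence a domain; local by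
`Parasite.isLocalRing_locPrime`), with the normality and dimension hypotheses in the shape T-GERM /
`Thread.threadTower_of_trdeg` deliver them. [this work] -/
theorem hasRationalSingularity_locPrime_of_isSandwichedGerm (h12 : Lipman1969_1_2.{0}) (T : Subalgebra k K)
    (Q : Ideal ↥T) (hQ : Q.IsPrime) (hIC : IsIntegrallyClosed ↥(locPrime T Q hQ))
    (hdim : ringKrullDim ↥(locPrime T Q hQ) = 2) (h : IsSandwichedGerm ↥(locPrime T Q hQ)) :
    HasRationalSingularity ↥(locPrime T Q hQ) := by
  haveI := Parasite.isLocalRing_locPrime T Q hQ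
  haveI := hIC
  exact h.hasRationalSingularity h12 hdim

end Thread

end Summit.ResolutionOfSingularities.ResolutionOfSingularities.Theorems.NoZeno.Sandwiched

end
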